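import Mathlib.Analysis.Calculus.MeanValue
import Summits.AtomisticToContinuum.FouriersLaw.Theorems.LocalOhmBVNoLocalIntegralsPartial

/-!
# `NoLocalIntegrals` helper B2: locality from vanishing partial derivatives

Helper file of the support item `NoLocalIntegrals` (stmt-AtomisticToContinuum-12074) of route `LocalOhmBV`
(sub-problem `FouriersLaw`): the converse of locality for smooth local observables — if both partial
derivatives at a site vanish identically, the observable does not depend on that site (two applications
of "zero derivative along a line implies constant"), and the version for a set of sites.
-/

noncomputable section

open scoped ContDiff
open Set Function Literature.MathematicalPhysics.KineticTheory.HeatConduction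

namespace Summit.AtomisticToContinuum.FouriersLaw.Theorems.LocalOhmBV

variable {f g : ChainConfig → ℝ}

/-! ### Vanishing partial derivatives at a site imply independence of that site -/

/-- Two configurations agreeing off `x` differ by an update at `x`. -/
theorem eq_update_of_forall_ne {σ σ' : ChainConfig} {x : ℤ} (h : ∀ i, i ≠ x → σ i = σ' i) :
    σ' = Function.update σ x (σ' x) := by
  funext i
  by_cases hi : i = x
  · subst hi; simp
  · rw [Function.update_of_ne hi, h i hi]

/-- **Locality from vanishing partials.** A smooth local observable whose position and momentum partial
derivatives at the site `x` vanish identically does not depend on the site `x` (two applications of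
"zero derivative along a line implies constant"). -/
theorem dependsOn_compl_singleton_of_partial_eq_zero (hf : IsSmoothLocal f) {x : ℤ}
    (hq : partialQZ x f = 0) (hp : partialPZ x f = 0) : DependsOn f ({x}ᶜ : Set ℤ) := by
  -- updates at `x` do not change `f`
  have key : ∀ (σ : ChainConfig) (v : ℝ × ℝ), f (Function.update σ x v) = f σ := by
    intro σ v
    -- move the position first
    have h1 : ∀ a : ℝ, f (Function.update σ x (a, (σ x).2)) = f σ := by
      intro a
      have hc := is_const_of_deriv_eq_zero
        ((contDiff_lineQ hf σ x (σ x).2).differentiable (by simp))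
        (fun t => by
          rw [← partialQZ_update_eq_deriv, hq]
          rfl) a (σ x).1
      rw [hc, Prod.mk.eta, Function.update_eq_self]
    -- then the momentum, from the moved configuration
    have h2 : ∀ a b : ℝ, f (Function.update σ x (a, b)) = f (Function.update σ x (a, (σ x).2)) := by
      intro a b
      have hc := is_const_of_deriv_eq_zero
        ((contDiff_lineP hf σ x a).differentiable (by simp))
        (fun t => by
          rw [← partialPZ_update_eq_deriv, hp]
          rfl) b (σ x).2
      exact hc
    obtain ⟨a, b⟩ := v
    rw [h2, h1]
  intro σ σ' h
  have h' : ∀ i, i ≠ x → σ i = σ' i := fun i hi => h i hi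
  rw [eq_update_of_forall_ne h', key]

/-- If `∂_{p_x} f = 0` then `f` does not depend on the momentum at `x` (zero derivative along the
momentum line). -/
theorem apply_update_eq_of_partialPZ_eq_zero (hf : IsSmoothLocal f) {x : ℤ} (hp : partialPZ x f = 0)
    (σ : ChainConfig) (a b : ℝ) : f (Function.update σ x (a, b)) = f (Function.update σ x (a, (σ x).2)) :=
  is_const_of_deriv_eq_zero ((contDiff_lineP hf σ x a).differentiable (by simp))
    (fun t => by
      rw [← partialPZ_update_eq_deriv, hp]
      rfl) b (σ x).2

/-- If `∂_{q_x} f = 0` then `f` does not depend on the position at `x`. -/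
theorem apply_update_eq_of_partialQZ_eq_zero (hf : IsSmoothLocal f) {x : ℤ} (hq : partialQZ x f = 0)
    (σ : ChainConfig) (a b : ℝ) : f (Function.update σ x (a, b)) = f (Function.update σ x ((σ x).1, b)) :=
  is_const_of_deriv_eq_zero ((contDiff_lineQ hf σ x b).differentiable (by simp))
    (fun t => by
      rw [← partialQZ_update_eq_deriv, hq]
      rfl) a (σ x).1

/-- A smooth local observable whose partial derivatives vanish at every site of a set `t` depends only on
the complement of `t`. -/
theorem dependsOn_of_partial_eq_zero (hf : IsSmoothLocal f) {t : Set ℤ}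
    (hq : ∀ x ∈ t, partialQZ x f = 0) (hp : ∀ x ∈ t, partialPZ x f = 0) : DependsOn f tᶜ := by
  classical
  obtain ⟨R, hR⟩ := IsSmoothLocal.exists_dependsOn hf
  -- remove the finitely many sites of `t` inside the box one at a time
  have h : ∀ s : Finset ℤ, (↑s : Set ℤ) ⊆ t → DependsOn f (Icc (-(R : ℤ)) R \ ↑s) := by
    intro s hs
    induction s using Finset.induction_on with
    | empty => simpa using hR
    | insert a s ha ih =>
      have hs' : (↑s : Set ℤ) ⊆ t := fun i hi => hs (Finset.mem_insert_of_mem hi)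
      have hat : a ∈ t := hs (Finset.mem_insert_self a s)
      have h12 := dependsOn_inter (ih hs')
        (dependsOn_compl_singleton_of_partial_eq_zero hf (hq a hat) (hp a hat))
      refine h12.mono ?_
      intro i hi
      refine ⟨hi.1.1, fun him => ?_⟩
      rw [Finset.coe_insert, Set.mem_insert_iff] at him
      rcases him with him | him
      · exact hi.2 (Set.mem_singleton_iff.2 him)
      · exact hi.1.2 him
  have hfin : (Icc (-(R : ℤ)) R ∩ t).Finite := (finite_Icc _ _).inter_of_left t
  have hsub : (↑hfin.toFinset : Set ℤ) ⊆ t := fun i hi =>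
    ((Finite.mem_toFinset hfin).1 (Finset.mem_coe.1 hi)).2
  refine (h hfin.toFinset hsub).mono ?_
  intro i hi hit
  exact hi.2 (Finset.mem_coe.2 ((Finite.mem_toFinset hfin).2 ⟨hi.1, hit⟩))

end Summit.AtomisticToContinuum.FouriersLaw.Theorems.LocalOhmBV
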